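import Literature.ModelTheory.PseudofiniteFields.LangWeilShapeTransfer
import Literature.NumberTheory.DiophantineGeometry.CafureMateraProofs
import Literature.NumberTheory.DiophantineGeometry.CafureMateraThm52Proofs
import Literature.ModelTheory.PseudofiniteFields.DefinableSetsFiniteFieldsDecomposition
import HarnessLib

/-!
# Proof of Chatzidakis–van den Dries–Macintyre Prop. 3.3 (Lang–Weil for algebraic sets)

Topic `Literature/ModelTheory/PseudofiniteFields`.  Discharge of the named fact
`ChatzidakisVanDenDriesMacintyre1992_prop33` (`DefinableSetsFiniteFieldsDecomposition.lean`):
for all `e, n, r` there are `C > 0` and `M` such that for every finite field `K` (`q = #K`) and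
every system `f₁, …, f_r ∈ K[X₁, …, Xₙ]` of degrees `≤ e`, the number `N` of `K`-rational zeros
is `0` or satisfies `|N - μ q^d| ≤ C q^{d - 1/2}` for some `d ≤ n`, `1 ≤ μ ≤ M`
(`ChatzidakisVanDenDriesMacintyre1992_prop33_holds`).  This is the Lang–Weil theorem
[LangWeil1954, Thm. 1] for arbitrary (not necessarily irreducible) affine algebraic sets with
the uniformity in the degrees that [ChatzidakisVanDenDriesMacintyre1992, Prop. 3.3] records.

Proof.  `LangWeilShapeTransfer.exists_decomposition_finiteField` gives `B, q₀` and, for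
`q ≥ q₀`, a rational-trace decomposition of the zero set of complexity `≤ B`: good pieces
`Z°_i` (`i < μ`) in bijection with `{m_i = 0, δ_i ≠ 0} ⊆ K^{1+d}` for absolutely irreducible
`m_i` of degree `≤ B`, and a cover of the rest and of the pairwise overlaps by `≤ B` Noether
charts with `d - 1` parameters.  Counting (`abs_card_sub_le_of_decomposition`):
`#V` differs from `Σ_i #Z°_i` by at most `(μ+1)·#W` (`card_le_of_cover`,
`sum_card_le_of_overlap`); `#Z°_i = #{m_i = 0} - #{m_i = 0, δ_i = 0}` (`card_filter_mem_eq`);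
`|#{m_i = 0} - q^d| ≤ B² q^{d-1/2} + 5B^{13/3} q^{d-1}` by Cafure–Matera's effective Lang–Weil
estimate for absolutely irreducible hypersurfaces (`CafureMatera2006_thm52_holds'`);
`#{m_i = 0, δ_i = 0} ≤ B² q^{d-1}` (`card_filter_bad_le`: Lemma 2.1 for `δ_i ≠ 0` and `≤ B`
roots of the monic `m_i(·, y)`); `#W ≤ B^{n+1} q^{d-1}` (`card_filter_chartMem_le`); in
dimension `0` every error term vanishes (`rationalPointCount_eq_one_of_dim_zero`).  For `q < q₀`
the trivial bound with `(d, μ) = (0, 1)`.  Corollary: the CDM Main Theorem from Prop. 2.7 alone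
(`ChatzidakisVanDenDriesMacintyre1992_mainTheorem_of_prop27`).

## References

* Z. Chatzidakis, L. van den Dries, A. Macintyre, Definable sets over finite fields, J. reine
  angew. Math. 427 (1992) 107–135, Prop. 3.3. [ChatzidakisVanDenDriesMacintyre1992]
* S. Lang, A. Weil, Number of points of varieties in finite fields, Amer. J. Math. 76 (1954)
  819–827, Thm. 1. [LangWeil1954]
* A. Cafure, G. Matera, Improved explicit estimates on the number of solutions of equations over
  a finite field, Finite Fields Appl. 12 (2006) 155–185, Thm. 5.2, Lemma 2.1. [CafureMatera2006]
-/

noncomputable section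

open MvPolynomial
open scoped Polynomial

namespace Literature.ModelTheory.PseudofiniteFields

open Literature.NumberTheory.DiophantineGeometry
/-! ### Counting the rational points of a decomposition over a finite field -/

section Counting

open Classical in
/-- A polynomial monic of degree `k` in `X₀` has at most `k` zeros on each line `{(·, y)}`.
[folklore] -/
theorem card_filter_eval_cons_le {K : Type} [Field K] [Fintype K] {d : ℕ}
    (m : MvPolynomial (Fin (d + 1)) K) {k : ℕ} (hm : MonicIn0 m k) (y : Fin d → K) :
    (Finset.univ.filter fun v : K => eval (Fin.cons v y : Fin (d + 1) → K) m = 0).card ≤ k := by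
  set p : K[X] := (finSuccEquiv K d m).map (eval y) with hp
  have hmon : p.Monic := hm.1.map _
  have hdeg : p.natDegree = k := by rw [hp, hm.1.natDegree_map, hm.2]
  have h0 : p ≠ 0 := hmon.ne_zero
  calc (Finset.univ.filter fun v : K => eval (Fin.cons v y : Fin (d + 1) → K) m = 0).card
      ≤ p.roots.toFinset.card := by
        refine Finset.card_le_card fun v hv => ?_
        simp only [Finset.mem_filter, Finset.mem_univ, true_and] at hv
        rw [eval_eq_eval_mv_eval'] at hv
        exact Multiset.mem_toFinset.mpr ((Polynomial.mem_roots h0).mpr hv)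
    _ ≤ Multiset.card p.roots := Multiset.toFinset_card_le _
    _ ≤ p.natDegree := Polynomial.card_roots' p
    _ = k := hdeg

variable {K : Type} [Field K] [Fintype K] {n d : ℕ}

open Classical in
/-- **The piece is parametrised by `{m = 0, δ ≠ 0}`**: `#Z° = #{z ∈ K^{1+d} | m(z) = 0, δ(tail z) ≠ 0}`
(the map `x ↦ (U x, T x)` is a bijection, by the graph equations and (d)). [folklore] -/
theorem card_filter_mem_eq (p : Piece K n d) (hp : p.Param) :
    (Finset.univ.filter fun x => p.Mem x).card =
      ((Finset.univ.filter fun z : Fin (d + 1) → K => eval z p.m = 0).filter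
        fun z => eval (Fin.tail z) p.δ ≠ 0).card := by
  refine Finset.card_bij (fun x _ => p.lift x) (fun x hx => ?_) (fun x hx x' hx' h => ?_)
    (fun z hz => ?_)
  · simp only [Finset.mem_filter, Finset.mem_univ, true_and] at hx ⊢
    refine ⟨hx.2.1, ?_⟩
    rw [Piece.lift, Fin.tail_cons]
    exact hx.1
  · simp only [Finset.mem_filter, Finset.mem_univ, true_and] at hx hx'
    have hpar : p.par x = p.par x' := by
      have h1 := congrArg Fin.tail h
      simpa only [Piece.lift, Fin.tail_cons] using h1
    funext j
    have h1 := hx.2.2 j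
    have h2 := hx'.2.2 j
    rw [h, hpar, ← h2] at h1
    exact mul_left_cancel₀ hx'.1 h1
  · simp only [Finset.mem_filter, Finset.mem_univ, true_and] at hz ⊢
    set y : Fin d → K := Fin.tail z with hy
    set v : K := z 0 with hv
    have hz' : z = Fin.cons v y := (Fin.cons_self_tail z).symm
    let x : Fin n → K := fun j => eval (Fin.cons v y : Fin (d + 1) → K) (p.w j) / eval y p.δ
    have hw : ∀ j, eval y p.δ * x j = eval (Fin.cons v y : Fin (d + 1) → K) (p.w j) := fun j => by
      simp only [x]
      rw [mul_div_assoc']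
      exact mul_div_cancel_left₀ _ hz.2
    have hm : eval (Fin.cons v y : Fin (d + 1) → K) p.m = 0 := by rw [← hz']; exact hz.1
    obtain ⟨hpar, hU⟩ := hp y v x hm hz.2 hw
    have hlift : p.lift x = z := by rw [Piece.lift, hU, hpar, ← hz']
    refine ⟨x, ⟨?_, ?_, fun j => ?_⟩, hlift⟩
    · rw [hpar]; exact hz.2
    · rw [hlift]; exact hz.1
    · rw [hpar, hlift, hz']; exact hw j

open Classical in
/-- Splitting `{m = 0}` along `δ(tail z) ≠ 0` / `= 0`. [folklore] -/
theorem card_filter_add (p : Piece K n d) :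
    ((Finset.univ.filter fun z : Fin (d + 1) → K => eval z p.m = 0).filter
        fun z => eval (Fin.tail z) p.δ ≠ 0).card +
      ((Finset.univ.filter fun z : Fin (d + 1) → K => eval z p.m = 0).filter
        fun z => ¬ eval (Fin.tail z) p.δ ≠ 0).card = rationalPointCount p.m :=
  Finset.card_filter_add_card_filter_not _

open Classical in
/-- **The bad part of the hypersurface is small**: `#{m = 0, δ(tail z) = 0} ≤ k · deg δ · q^{d-1}`
(`≤ k` zeros of the monic `m(·, y)` over each of the `≤ deg δ · q^{d-1}` zeros `y` of `δ ≠ 0`,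
Cafure–Matera Lemma 2.1). [cite: CafureMatera2006, Lemma 2.1] -/
theorem card_filter_bad_le (p : Piece K n d) {k : ℕ} (hm : MonicIn0 p.m k) (hδ : p.δ ≠ 0) :
    ((Finset.univ.filter fun z : Fin (d + 1) → K => eval z p.m = 0).filter
        fun z => ¬ eval (Fin.tail z) p.δ ≠ 0).card ≤
      k * (p.δ.totalDegree * Fintype.card K ^ (d - 1)) := by
  set Hbad := (Finset.univ.filter fun z : Fin (d + 1) → K => eval z p.m = 0).filter
    fun z => ¬ eval (Fin.tail z) p.δ ≠ 0 with hHbad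
  set Y := Finset.univ.filter fun y : Fin d → K => eval y p.δ = 0 with hY
  have hmaps : (Hbad : Set (Fin (d + 1) → K)).MapsTo Fin.tail Y := by
    intro z hz
    simp only [hHbad, Finset.coe_filter, Set.mem_setOf_eq, not_not] at hz
    simp only [hY, Finset.coe_filter, Finset.mem_univ, true_and, Set.mem_setOf_eq]
    exact hz.2
  rw [Finset.card_eq_sum_card_fiberwise hmaps]
  have hfib : ∀ y ∈ Y, (Hbad.filter fun z => Fin.tail z = y).card ≤ k := by
    intro y _
    refine le_trans ?_ (card_filter_eval_cons_le p.m hm y)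
    refine Finset.card_le_card_of_injOn (fun z => z 0) (fun z hz => ?_) (fun z hz z' hz' h => ?_)
    · simp only [hHbad, Finset.coe_filter, Finset.mem_filter, Finset.mem_univ, true_and,
        Set.mem_setOf_eq] at hz ⊢
      rw [← hz.2, Fin.cons_self_tail]
      exact hz.1.1
    · simp only [hHbad, Finset.coe_filter, Finset.mem_filter, Finset.mem_univ, true_and,
        Set.mem_setOf_eq] at hz hz'
      have h0 : z 0 = z' 0 := h
      rw [← Fin.cons_self_tail z, ← Fin.cons_self_tail z', h0, hz.2, hz'.2]
  calc ∑ y ∈ Y, (Hbad.filter fun z => Fin.tail z = y).card ≤ ∑ _y ∈ Y, k :=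
        Finset.sum_le_sum hfib
    _ = Y.card * k := by rw [Finset.sum_const, smul_eq_mul]
    _ ≤ (p.δ.totalDegree * Fintype.card K ^ (d - 1)) * k :=
        Nat.mul_le_mul_right k (rationalPointCount_le_totalDegree_mul hδ)
    _ = k * (p.δ.totalDegree * Fintype.card K ^ (d - 1)) := Nat.mul_comm _ _

open Classical in
/-- **Charts are small**: a chart with `d'` parameters and equations monic in `X₀` of degree
`≤ B` has at most `B^n q^{d'}` rational points. [folklore] -/
theorem card_filter_chartMem_le {d' : ℕ} (c : Chart K n d') {B : ℕ}
    (hmonic : ∀ j, ∃ k, 1 ≤ k ∧ k ≤ B ∧ MonicIn0 (c.N j) k) :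
    (Finset.univ.filter fun x => c.Mem x).card ≤ B ^ n * Fintype.card K ^ d' := by
  set C := Finset.univ.filter fun x => c.Mem x with hC
  have hmaps : (C : Set (Fin n → K)).MapsTo c.par (Finset.univ : Finset (Fin d' → K)) :=
    fun x _ => Finset.mem_coe.mpr (Finset.mem_univ _)
  rw [Finset.card_eq_sum_card_fiberwise hmaps]
  have hfib : ∀ y ∈ (Finset.univ : Finset (Fin d' → K)),
      (C.filter fun x => c.par x = y).card ≤ B ^ n := by
    intro y _
    let R : Fin n → Finset K := fun j =>
      Finset.univ.filter fun t : K => eval (Fin.cons t y : Fin (d' + 1) → K) (c.N j) = 0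
    have hR : ∀ j, (R j).card ≤ B := fun j => by
      obtain ⟨k, -, hkB, hmon⟩ := hmonic j
      exact (card_filter_eval_cons_le (c.N j) hmon y).trans hkB
    calc (C.filter fun x => c.par x = y).card ≤ (Fintype.piFinset R).card := by
          refine Finset.card_le_card fun x hx => ?_
          simp only [hC, Finset.mem_filter, Finset.mem_univ, true_and] at hx
          rw [Fintype.mem_piFinset]
          intro j
          simp only [R, Finset.mem_filter, Finset.mem_univ, true_and]
          rw [← hx.2]
          exact hx.1 j
      _ = ∏ j, (R j).card := Fintype.card_piFinset R
      _ ≤ ∏ _j : Fin n, B := Finset.prod_le_prod' fun j _ => hR j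
      _ = B ^ n := by simp
  calc ∑ y ∈ (Finset.univ : Finset (Fin d' → K)), (C.filter fun x => c.par x = y).card
      ≤ ∑ _y ∈ (Finset.univ : Finset (Fin d' → K)), B ^ n := Finset.sum_le_sum hfib
    _ = B ^ n * Fintype.card K ^ d' := by
        rw [Finset.sum_const, smul_eq_mul, Finset.card_univ, Fintype.card_fun, Fintype.card_fin,
          Nat.mul_comm]

omit [Field K] [Fintype K] in
open Classical in
/-- Upper bound from the cover (b): `#V ≤ #W + Σ_i #Z°_i`. [folklore] -/
theorem card_le_of_cover {μ : ℕ} (V : Finset (Fin n → K)) (Z : Fin μ → Finset (Fin n → K))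
    (W : Finset (Fin n → K)) (hcover : ∀ x ∈ V, x ∈ W ∨ ∃ i, x ∈ Z i) :
    V.card ≤ W.card + ∑ i, (Z i).card := by
  calc V.card ≤ (W ∪ Finset.univ.biUnion Z).card := by
        refine Finset.card_le_card fun x hx => ?_
        rcases hcover x hx with h | ⟨i, hi⟩
        · exact Finset.mem_union_left _ h
        · exact Finset.mem_union_right _ (Finset.mem_biUnion.mpr ⟨i, Finset.mem_univ _, hi⟩)
    _ ≤ W.card + (Finset.univ.biUnion Z).card := Finset.card_union_le _ _
    _ ≤ W.card + ∑ i, (Z i).card := Nat.add_le_add_left Finset.card_biUnion_le _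

omit [Field K] [Fintype K] in
open Classical in
/-- Lower bound from (a) and (c): `Σ_i #Z°_i ≤ #V + μ #W` (the sets `Z°_i ∖ W` are disjoint
subsets of `V`). [folklore] -/
theorem sum_card_le_of_overlap {μ : ℕ} (V : Finset (Fin n → K)) (Z : Fin μ → Finset (Fin n → K))
    (W : Finset (Fin n → K)) (hsub : ∀ i, Z i ⊆ V)
    (hover : ∀ i i' x, i ≠ i' → x ∈ Z i → x ∈ Z i' → x ∈ W) :
    ∑ i, (Z i).card ≤ V.card + μ * W.card := by
  have hdisj : (Set.univ : Set (Fin μ)).PairwiseDisjoint fun i => Z i \ W := by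
    intro i _ i' _ hii'
    rw [Function.onFun, Finset.disjoint_left]
    intro x hx hx'
    rw [Finset.mem_sdiff] at hx hx'
    exact hx.2 (hover i i' x hii' hx.1 hx'.1)
  have h1 : ∑ i, (Z i \ W).card ≤ V.card := by
    rw [← Finset.card_biUnion (by simpa using hdisj)]
    refine Finset.card_le_card fun x hx => ?_
    obtain ⟨i, -, hi⟩ := Finset.mem_biUnion.mp hx
    exact hsub i (Finset.mem_sdiff.mp hi).1
  calc ∑ i, (Z i).card ≤ ∑ i, ((Z i \ W).card + W.card) :=
        Finset.sum_le_sum fun i _ => Finset.card_le_card_sdiff_add_card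
    _ = ∑ i, (Z i \ W).card + μ * W.card := by
        rw [Finset.sum_add_distrib, Finset.sum_const, smul_eq_mul, Finset.card_univ, Fintype.card_fin]
    _ ≤ V.card + μ * W.card := Nat.add_le_add_right h1 _

open Classical in
/-- In dimension `0` a good piece is ONE point: an absolutely irreducible `m ∈ K[X₀]` monic in
`X₀` is linear, so `{m = 0} ⊆ K¹` is a single point. [folklore] -/
theorem rationalPointCount_eq_one_of_dim_zero (m : MvPolynomial (Fin (0 + 1)) K)
    (habs : IsAbsIrreducible m) {k : ℕ} (hm : MonicIn0 m k) : rationalPointCount m = 1 := by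
  have hk : k = 1 := eq_one_of_isAbsIrreducible_of_monicIn0 habs hm
  subst hk
  -- the univariate polynomial `p(X) = m(X, ·)` over `K` (no parameters)
  set y₀ : Fin 0 → K := Fin.elim0 with hy₀
  set p : K[X] := (finSuccEquiv K 0 m).map (eval y₀) with hp
  have hmon : p.Monic := hm.1.map _
  have hdeg : p.natDegree = 1 := by rw [hp, hm.1.natDegree_map, hm.2]
  -- `p = X + c`, unique root `-c`
  have hpX : p = Polynomial.X + Polynomial.C (p.coeff 0) := by
    rw [hmon.eq_X_add_C hdeg]
    simp
  have hroot : ∀ v : K, p.eval v = 0 ↔ v = -p.coeff 0 := fun v => by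
    rw [hpX]
    simp only [Polynomial.eval_add, Polynomial.eval_X, Polynomial.eval_C, Polynomial.coeff_add,
      Polynomial.coeff_X_zero, Polynomial.coeff_C_zero, zero_add]
    constructor
    · intro h; linear_combination h
    · intro h; rw [h]; ring
  unfold rationalPointCount
  rw [Finset.card_eq_one]
  refine ⟨Fin.cons (-p.coeff 0) y₀, ?_⟩
  ext z
  simp only [Finset.mem_filter, Finset.mem_univ, true_and, Finset.mem_singleton]
  have hz : z = Fin.cons (z 0) y₀ := by
    rw [show y₀ = Fin.tail z from Subsingleton.elim _ _]
    exact (Fin.cons_self_tail z).symm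
  rw [hz, eval_eq_eval_mv_eval', ← hp, hroot]
  constructor
  · intro h; rw [h]
  · intro h
    have := congrFun h 0
    simpa using this

end Counting

/-! ### The Lang–Weil estimate for a decomposition -/

section Estimate

variable {K : Type} [Field K] [Fintype K] {n B : ℕ}

omit [Fintype K] in
/-- Total degree of a polynomial in no variables. [folklore] -/
theorem totalDegree_fin_zero (δ : MvPolynomial (Fin 0) K) : δ.totalDegree = 0 := by
  rw [δ.eq_C_of_isEmpty, totalDegree_C]

open Classical in
/-- **Effective Lang–Weil for a decomposition over a finite field.**  If the finite set `Vs` of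
points of `V ⊆ Kⁿ` has a rational-trace decomposition of complexity `B` with dimension `d` and
`μ` good pieces, then `|#V - μ q^d| ≤ C₀(B, n) q^{d - 1/2}` with the explicit
`C₀(B, n) = (B+1) B^{n+1} + B (2B² + 5B⁵ + 2)`.  Proof: `#V` differs from
`Σ_i #Z°_i` by at most `(μ + 1) #W` (cover, disjointness off `W`); `#Z°_i = #{m_i = 0, δ_i ≠ 0}`
(parametrisation); `#{m_i = 0} = q^d + O(q^{d-1/2})` (Cafure–Matera Thm 5.2, `m_i` absolutely
irreducible) and `#{m_i = 0, δ_i = 0} ≤ B² q^{d-1}`, `#W ≤ B^{n+1} q^{d-1}`; in dimension `0`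
all error terms vanish. [cite: CafureMatera2006, Thm. 5.2] [cite: LangWeil1954, Thm. 1] -/
theorem abs_card_sub_le_of_decomposition {V : Set (Fin n → K)} (𝒟 : Decomposition K n V B)
    (Vs : Finset (Fin n → K)) (hVs : ∀ x, x ∈ Vs ↔ x ∈ V) :
    |(Vs.card : ℝ) - 𝒟.μ * (Fintype.card K : ℝ) ^ 𝒟.d| ≤
      (((B + 1) * B ^ (n + 1) + B * (2 * B ^ 2 + 5 * B ^ 5 + 2) : ℕ) : ℝ) *
        (Fintype.card K : ℝ) ^ ((𝒟.d : ℝ) - 1 / 2) := by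
  obtain ⟨d, μ, piece, L, chart, hdn, h1μ, hμB, hLB, hL0, hpdeg, hcdeg, hpmon, hcmon, habs, hδ,
    hsub, hcov, hover, hpar⟩ := 𝒟
  dsimp only
  set q : ℕ := Fintype.card K with hq
  have hq1 : (1 : ℝ) ≤ q := by exact_mod_cast Fintype.card_pos
  have hq0 : (0 : ℝ) ≤ q := Nat.cast_nonneg _
  have hB1 : 1 ≤ B := h1μ.trans hμB
  -- the finite sets
  set Z : Fin μ → Finset (Fin n → K) := fun i => Finset.univ.filter fun x => (piece i).Mem x with hZ
  set W : Finset (Fin n → K) := Finset.univ.filter fun x => ∃ l, (chart l).Mem x with hW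
  set S : Fin μ → Finset (Fin (d + 1) → K) := fun i =>
    (Finset.univ.filter fun z : Fin (d + 1) → K => eval z (piece i).m = 0).filter
      fun z => eval (Fin.tail z) (piece i).δ ≠ 0 with hS
  set Bad : Fin μ → Finset (Fin (d + 1) → K) := fun i =>
    (Finset.univ.filter fun z : Fin (d + 1) → K => eval z (piece i).m = 0).filter
      fun z => ¬ eval (Fin.tail z) (piece i).δ ≠ 0 with hBad
  -- combinatorics in `ℕ`
  have hZS : ∀ i, (Z i).card = (S i).card := fun i => card_filter_mem_eq (piece i) (hpar i)
  have hSH : ∀ i, (S i).card + (Bad i).card = rationalPointCount (piece i).m := fun i =>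
    card_filter_add (piece i)
  have hcover : Vs.card ≤ W.card + ∑ i, (Z i).card := by
    refine card_le_of_cover Vs Z W fun x hx => ?_
    rcases hcov x ((hVs x).mp hx) with ⟨l, hl⟩ | ⟨i, hi⟩
    · exact Or.inl (by simp [hW]; exact ⟨l, hl⟩)
    · exact Or.inr ⟨i, by simp [hZ]; exact hi⟩
  have hoverlap : ∑ i, (Z i).card ≤ Vs.card + μ * W.card := by
    refine sum_card_le_of_overlap Vs Z W (fun i x hx => ?_) (fun i i' x hii' hx hx' => ?_)
    · simp only [hZ, Finset.mem_filter, Finset.mem_univ, true_and] at hx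
      exact (hVs x).mpr (hsub i x hx)
    · simp only [hZ, Finset.mem_filter, Finset.mem_univ, true_and] at hx hx'
      simp only [hW, Finset.mem_filter, Finset.mem_univ, true_and]
      exact hover i i' x hii' hx hx'
  -- the main inequality in `ℝ`, with the error terms left symbolic
  have hmain : |(Vs.card : ℝ) - μ * (q : ℝ) ^ d| ≤
      (μ + 1) * W.card + ∑ i, (|(rationalPointCount (piece i).m : ℝ) - (q : ℝ) ^ d| + (Bad i).card) := by
    have h1 : |(Vs.card : ℝ) - ∑ i, ((S i).card : ℝ)| ≤ (μ + 1) * W.card := by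
      have hc : (Vs.card : ℝ) ≤ W.card + ∑ i, ((S i).card : ℝ) := by
        have := hcover; simp only [hZS] at this; exact_mod_cast this
      have ho : ∑ i, ((S i).card : ℝ) ≤ Vs.card + μ * W.card := by
        have := hoverlap; simp only [hZS] at this; exact_mod_cast this
      rw [abs_le]
      constructor <;> nlinarith [Nat.cast_nonneg (α := ℝ) W.card, Nat.cast_nonneg (α := ℝ) μ]
    have h2 : |∑ i, ((S i).card : ℝ) - μ * (q : ℝ) ^ d| ≤
        ∑ i, (|(rationalPointCount (piece i).m : ℝ) - (q : ℝ) ^ d| + (Bad i).card) := by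
      have hsum : ∑ i, ((S i).card : ℝ) - μ * (q : ℝ) ^ d = ∑ i : Fin μ, (((S i).card : ℝ) - (q : ℝ) ^ d) := by
        rw [Finset.sum_sub_distrib, Finset.sum_const, Finset.card_univ, Fintype.card_fin, nsmul_eq_mul]
      rw [hsum]
      refine (Finset.abs_sum_le_sum_abs _ _).trans (Finset.sum_le_sum fun i _ => ?_)
      have hS' : ((S i).card : ℝ) = rationalPointCount (piece i).m - (Bad i).card := by
        have := hSH i
        have h' : ((S i).card : ℝ) + (Bad i).card = rationalPointCount (piece i).m := by exact_mod_cast this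
        linarith
      rw [hS']
      have hb : (0 : ℝ) ≤ (Bad i).card := Nat.cast_nonneg _
      rw [abs_le]
      constructor
      · have := neg_abs_le ((rationalPointCount (piece i).m : ℝ) - (q : ℝ) ^ d)
        linarith
      · have := le_abs_self ((rationalPointCount (piece i).m : ℝ) - (q : ℝ) ^ d)
        linarith
    calc |(Vs.card : ℝ) - μ * (q : ℝ) ^ d|
        ≤ |(Vs.card : ℝ) - ∑ i, ((S i).card : ℝ)| + |∑ i, ((S i).card : ℝ) - μ * (q : ℝ) ^ d| :=
          abs_sub_le _ _ _
      _ ≤ _ := add_le_add h1 h2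
  refine hmain.trans ?_
  -- bounding the error terms
  rcases Nat.eq_zero_or_pos d with hd0 | hdpos
  · -- dimension 0: all error terms vanish
    subst hd0
    have hW0 : W.card = 0 := by
      rw [Finset.card_eq_zero, Finset.eq_empty_iff_forall_notMem]
      intro x hx
      simp only [hW, Finset.mem_filter, Finset.mem_univ, true_and] at hx
      obtain ⟨l, -⟩ := hx
      have hL := hL0 rfl
      subst hL
      exact Fin.elim0 l
    have hH1 : ∀ i, rationalPointCount (piece i).m = 1 := fun i => by
      obtain ⟨k, -, hmon⟩ := hpmon i
      exact rationalPointCount_eq_one_of_dim_zero (piece i).m (habs i) hmon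
    have hBad0 : ∀ i, (Bad i).card = 0 := fun i => by
      obtain ⟨k, -, hmon⟩ := hpmon i
      have h := card_filter_bad_le (piece i) hmon (hδ i)
      rw [totalDegree_fin_zero, zero_mul, mul_zero] at h
      exact Nat.le_zero.mp h
    simp only [hW0, hH1, hBad0, Nat.cast_zero, Nat.cast_one, mul_zero, pow_zero, sub_self, abs_zero,
      add_zero, Finset.sum_const_zero]
    exact mul_nonneg (Nat.cast_nonneg _) (Real.rpow_nonneg hq0 _)
  · -- dimension `d ≥ 1`
    obtain ⟨d', rfl⟩ : ∃ d', d = d' + 1 := ⟨d - 1, by omega⟩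
    set P : ℝ := (q : ℝ) ^ d' with hP
    set Q : ℝ := (q : ℝ) ^ (((d' + 1 : ℕ) : ℝ) - 1 / 2) with hQ
    have hP0 : 0 ≤ P := pow_nonneg hq0 _
    have hPQ : P ≤ Q := by
      have h : P = (q : ℝ) ^ ((d' : ℕ) : ℝ) := (Real.rpow_natCast _ _).symm
      rw [h, hQ]
      refine Real.rpow_le_rpow_of_exponent_le hq1 ?_
      push_cast; linarith
    have hQ0 : 0 ≤ Q := Real.rpow_nonneg hq0 _
    -- `#W ≤ L B^n q^{d'}`
    have hWle : (W.card : ℝ) ≤ B * (B ^ n * P) := by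
      have hnat : W.card ≤ L * (B ^ n * q ^ d') := by
        calc W.card ≤ (Finset.univ.biUnion fun l => Finset.univ.filter fun x => (chart l).Mem x).card := by
              refine Finset.card_le_card fun x hx => ?_
              simp only [hW, Finset.mem_filter, Finset.mem_univ, true_and] at hx
              obtain ⟨l, hl⟩ := hx
              exact Finset.mem_biUnion.mpr ⟨l, Finset.mem_univ _, by simpa using hl⟩
          _ ≤ ∑ l, (Finset.univ.filter fun x => (chart l).Mem x).card := Finset.card_biUnion_le
          _ ≤ ∑ _l : Fin L, B ^ n * q ^ d' := by
              refine Finset.sum_le_sum fun l _ => ?_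
              refine card_filter_chartMem_le (chart l) fun j => ?_
              obtain ⟨k, hk1, hmon⟩ := hcmon l j
              exact ⟨k, hk1, (le_of_monicIn0 hmon).trans ((hcdeg l).2 j), hmon⟩
          _ = L * (B ^ n * q ^ d') := by
              rw [Finset.sum_const, Finset.card_univ, Fintype.card_fin, smul_eq_mul]
      have h' : (W.card : ℝ) ≤ L * (B ^ n * P) := by rw [hP]; exact_mod_cast hnat
      have hLB' : (L : ℝ) ≤ B := by exact_mod_cast hLB
      have hBn : (0 : ℝ) ≤ B ^ n * P := by positivity
      nlinarith
    -- `#Bad_i ≤ B² q^{d'}`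
    have hBadle : ∀ i, ((Bad i).card : ℝ) ≤ B * (B * P) := fun i => by
      obtain ⟨k, hk1, hmon⟩ := hpmon i
      have hkB : k ≤ B := (le_of_monicIn0 hmon).trans (hpdeg i).2.2.1
      have h := card_filter_bad_le (piece i) hmon (hδ i)
      rw [Nat.add_sub_cancel] at h
      have h' : (Bad i).card ≤ B * (B * q ^ d') :=
        h.trans (Nat.mul_le_mul hkB (Nat.mul_le_mul_right _ (hpdeg i).2.2.2.1))
      rw [hP]; exact_mod_cast h'
    -- `|#{m_i = 0} - q^d| ≤ (B² + 2) Q + 5 B⁵ P` (Cafure–Matera Thm 5.2)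
    have hHle : ∀ i, |(rationalPointCount (piece i).m : ℝ) - (q : ℝ) ^ (d' + 1)| ≤
        ((B : ℝ) ^ 2 + 2) * Q + 5 * (B : ℝ) ^ 5 * P := fun i => by
      have h52 := CafureMatera2006_thm52_holds' K (d' + 1 + 1) (piece i).m (habs i)
      set δ : ℕ := (piece i).m.totalDegree with hδdef
      have hδB : (δ : ℝ) ≤ B := by exact_mod_cast (hpdeg i).2.2.1
      have hδ0 : (0 : ℝ) ≤ δ := Nat.cast_nonneg _
      have hB1' : (1 : ℝ) ≤ B := by exact_mod_cast hB1
      -- exponents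
      have he1 : (q : ℝ) ^ (((d' + 1 + 1 : ℕ) : ℝ) - 1) = (q : ℝ) ^ (d' + 1) := by
        rw [← Real.rpow_natCast]; congr 1; push_cast; ring
      have he2 : (q : ℝ) ^ (((d' + 1 + 1 : ℕ) : ℝ) - 3 / 2) = Q := by
        rw [hQ]; congr 1; push_cast; ring
      have he3 : (q : ℝ) ^ (((d' + 1 + 1 : ℕ) : ℝ) - 2) = P := by
        rw [hP, ← Real.rpow_natCast]; congr 1; push_cast; ring
      rw [he1, he2, he3] at h52
      refine h52.trans ?_
      have hc1 : ((δ : ℝ) - 1) * ((δ : ℝ) - 2) ≤ (B : ℝ) ^ 2 + 2 := by nlinarith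
      have hc2 : (δ : ℝ) ^ ((13 : ℝ) / 3) ≤ (B : ℝ) ^ 5 := by
        calc (δ : ℝ) ^ ((13 : ℝ) / 3) ≤ (B : ℝ) ^ ((13 : ℝ) / 3) :=
              Real.rpow_le_rpow hδ0 hδB (by norm_num)
          _ ≤ (B : ℝ) ^ ((5 : ℕ) : ℝ) := Real.rpow_le_rpow_of_exponent_le hB1' (by norm_num)
          _ = (B : ℝ) ^ 5 := Real.rpow_natCast _ _
      have hc20 : 0 ≤ (δ : ℝ) ^ ((13 : ℝ) / 3) := Real.rpow_nonneg hδ0 _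
      nlinarith
    -- summing up
    have hsum : ∑ i : Fin μ, (|(rationalPointCount (piece i).m : ℝ) - (q : ℝ) ^ (d' + 1)| + ((Bad i).card : ℝ))
        ≤ μ * (((B : ℝ) ^ 2 + 2) * Q + 5 * (B : ℝ) ^ 5 * P + B * (B * P)) := by
      calc ∑ i : Fin μ, (|(rationalPointCount (piece i).m : ℝ) - (q : ℝ) ^ (d' + 1)| + ((Bad i).card : ℝ))
          ≤ ∑ _i : Fin μ, (((B : ℝ) ^ 2 + 2) * Q + 5 * (B : ℝ) ^ 5 * P + B * (B * P)) :=
            Finset.sum_le_sum fun i _ => add_le_add (hHle i) (hBadle i)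
        _ = μ * (((B : ℝ) ^ 2 + 2) * Q + 5 * (B : ℝ) ^ 5 * P + B * (B * P)) := by
            rw [Finset.sum_const, Finset.card_univ, Fintype.card_fin, nsmul_eq_mul]
    have hμB' : (μ : ℝ) ≤ B := by exact_mod_cast hμB
    have hμ0 : (0 : ℝ) ≤ μ := Nat.cast_nonneg _
    have hB0 : (0 : ℝ) ≤ B := Nat.cast_nonneg _
    have hfinal : ((μ : ℝ) + 1) * W.card + μ * (((B : ℝ) ^ 2 + 2) * Q + 5 * (B : ℝ) ^ 5 * P + B * (B * P))
        ≤ (((B + 1) * B ^ (n + 1) + B * (2 * B ^ 2 + 5 * B ^ 5 + 2) : ℕ) : ℝ) * Q := by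
      have e1 : ((μ : ℝ) + 1) * W.card ≤ ((B : ℝ) + 1) * (B * (B ^ n * Q)) := by
        have : (W.card : ℝ) ≤ B * (B ^ n * Q) := hWle.trans (by gcongr)
        have hW0 : (0 : ℝ) ≤ W.card := Nat.cast_nonneg _
        nlinarith
      have e2 : (μ : ℝ) * (((B : ℝ) ^ 2 + 2) * Q + 5 * (B : ℝ) ^ 5 * P + B * (B * P)) ≤
          B * (((B : ℝ) ^ 2 + 2) * Q + 5 * (B : ℝ) ^ 5 * Q + B * (B * Q)) := by
        have hin : ((B : ℝ) ^ 2 + 2) * Q + 5 * (B : ℝ) ^ 5 * P + B * (B * P) ≤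
            ((B : ℝ) ^ 2 + 2) * Q + 5 * (B : ℝ) ^ 5 * Q + B * (B * Q) := by gcongr
        have hnn : 0 ≤ ((B : ℝ) ^ 2 + 2) * Q + 5 * (B : ℝ) ^ 5 * P + B * (B * P) := by positivity
        nlinarith
      have e3 : ((B : ℝ) + 1) * (B * (B ^ n * Q)) + B * (((B : ℝ) ^ 2 + 2) * Q + 5 * (B : ℝ) ^ 5 * Q + B * (B * Q))
          = (((B + 1) * B ^ (n + 1) + B * (2 * B ^ 2 + 5 * B ^ 5 + 2) : ℕ) : ℝ) * Q := by
        push_cast; ring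
      linarith
    exact (add_le_add le_rfl hsum).trans hfinal

end Estimate

/-! ### Proposition 3.3 -/

section Prop33

/-- **Chatzidakis–van den Dries–Macintyre (1992), Prop. 3.3 — PROVED**: the Lang–Weil estimate for
arbitrary affine algebraic sets over finite fields, uniformly in the degrees (discharge of the
named fact `ChatzidakisVanDenDriesMacintyre1992_prop33`).  Proof: for `q ≥ q₀(e, n, r)` the
zero set has a rational-trace decomposition of complexity `≤ B(e, n, r)`
(`exists_decomposition_finiteField`: Theorem A over pseudo-finite fields + compactness +
transfer) and the decomposition is counted by `abs_card_sub_le_of_decomposition`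
(Cafure–Matera's effective Lang–Weil for absolutely irreducible hypersurfaces); for `q < q₀` the
trivial bound with `(d, μ) = (0, 1)`.
[cite: ChatzidakisVanDenDriesMacintyre1992, Prop. 3.3] [cite: LangWeil1954, Thm. 1] -/
theorem ChatzidakisVanDenDriesMacintyre1992_prop33_holds :
    ChatzidakisVanDenDriesMacintyre1992_prop33 := by
  intro e n r
  obtain ⟨B, q₀, hBq⟩ := exists_decomposition_finiteField e n r
  refine ⟨max (((B + 1) * B ^ (n + 1) + B * (2 * B ^ 2 + 5 * B ^ 5 + 2) : ℕ) : ℝ)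
      (2 * ((q₀ : ℝ) + 1) ^ (n + 1)), max B 1, lt_max_of_lt_right (by positivity), ?_⟩
  intro K _ _ f hf
  classical
  set Vs : Finset (Fin n → K) := Finset.univ.filter fun y : Fin n → K => ∀ i, eval y (f i) = 0
    with hVs
  have hcard : Nat.card {y : Fin n → K // ∀ i, MvPolynomial.eval y (f i) = 0} = Vs.card := by
    rw [Nat.card_eq_fintype_card, Fintype.card_subtype]
  rw [hcard]
  by_cases hV0 : Vs.card = 0
  · exact Or.inl hV0
  right
  have hq1 : (1 : ℝ) ≤ Fintype.card K := by exact_mod_cast Fintype.card_pos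
  have hq0 : (0 : ℝ) ≤ Fintype.card K := Nat.cast_nonneg _
  by_cases hq : q₀ ≤ Fintype.card K
  · rcases hBq K hq f hf with hempty | hne
    · exfalso
      apply hV0
      rw [Finset.card_eq_zero, Finset.eq_empty_iff_forall_notMem]
      intro x hx
      have hx' : x ∈ {x : Fin n → K | ∀ i, eval x (f i) = 0} := by
        simpa [hVs] using hx
      rw [hempty] at hx'
      exact hx'
    · let 𝒟 := Classical.choice hne
      refine ⟨𝒟.d, 𝒟.μ, ⟨𝒟.d_le, 𝒟.one_le_μ, 𝒟.μ_le.trans (le_max_left _ _)⟩, ?_⟩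
      have h := abs_card_sub_le_of_decomposition 𝒟 Vs (fun x => by simp [hVs])
      exact h.trans (mul_le_mul_of_nonneg_right (le_max_left _ _) (Real.rpow_nonneg hq0 _))
  · -- small fields: `(d, μ) = (0, 1)` and the trivial bound
    push Not at hq
    refine ⟨0, 1, ⟨Nat.zero_le _, le_rfl, le_max_right _ _⟩, ?_⟩
    set q : ℝ := (Fintype.card K : ℝ) with hqdef
    have hVle : (Vs.card : ℝ) ≤ q ^ n := by
      have h : Vs.card ≤ Fintype.card K ^ n :=
        (Finset.card_filter_le _ _).trans (by rw [Finset.card_univ, Fintype.card_fun, Fintype.card_fin])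
      rw [hqdef]; exact_mod_cast h
    have hqq₀ : q ≤ (q₀ : ℝ) + 1 := by
      rw [hqdef]
      have : (Fintype.card K : ℝ) ≤ q₀ := by exact_mod_cast hq.le
      linarith
    have hpow : q ^ n ≤ ((q₀ : ℝ) + 1) ^ n := pow_le_pow_left₀ hq0 hqq₀ n
    -- `q^{-1/2} ≥ 1/q ≥ 1/(q₀ + 1)`
    have hrpow : ((q₀ : ℝ) + 1)⁻¹ ≤ q ^ (((0 : ℕ) : ℝ) - 1 / 2) := by
      calc ((q₀ : ℝ) + 1)⁻¹ ≤ q⁻¹ := by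
            rw [inv_le_inv₀ (by positivity) (by linarith)]
            exact hqq₀
        _ = q ^ (-1 : ℝ) := (Real.rpow_neg_one q).symm
        _ ≤ q ^ (((0 : ℕ) : ℝ) - 1 / 2) := Real.rpow_le_rpow_of_exponent_le hq1 (by norm_num)
    have hC : 2 * ((q₀ : ℝ) + 1) ^ (n + 1) * ((q₀ : ℝ) + 1)⁻¹ = 2 * ((q₀ : ℝ) + 1) ^ n := by
      have hne : (q₀ : ℝ) + 1 ≠ 0 := by positivity
      field_simp
      ring
    have habs : |(Vs.card : ℝ) - ((1 : ℕ) : ℝ) * q ^ 0| ≤ 2 * ((q₀ : ℝ) + 1) ^ n := by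
      rw [Nat.cast_one, one_mul, pow_zero, abs_le]
      have hV0' : (0 : ℝ) ≤ Vs.card := Nat.cast_nonneg _
      have h1 : (1 : ℝ) ≤ ((q₀ : ℝ) + 1) ^ n := one_le_pow₀ (by linarith [(Nat.cast_nonneg q₀ : (0:ℝ) ≤ q₀)])
      constructor <;> nlinarith
    calc |(Vs.card : ℝ) - ((1 : ℕ) : ℝ) * q ^ 0| ≤ 2 * ((q₀ : ℝ) + 1) ^ n := habs
      _ = 2 * ((q₀ : ℝ) + 1) ^ (n + 1) * ((q₀ : ℝ) + 1)⁻¹ := hC.symm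
      _ ≤ max (((B + 1) * B ^ (n + 1) + B * (2 * B ^ 2 + 5 * B ^ 5 + 2) : ℕ) : ℝ)
            (2 * ((q₀ : ℝ) + 1) ^ (n + 1)) * q ^ (((0 : ℕ) : ℝ) - 1 / 2) :=
          mul_le_mul (le_max_right _ _) hrpow (by positivity) (le_trans (by positivity) (le_max_right _ _))

end Prop33


/-- **The CDM Main Theorem from Prop. 2.7 alone** (Prop. 3.3 being proved above).
[cite: ChatzidakisVanDenDriesMacintyre1992, §3 (3.7)] -/
theorem ChatzidakisVanDenDriesMacintyre1992_mainTheorem_of_prop27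
    (h27 : ChatzidakisVanDenDriesMacintyre1992_prop27) :
    ChatzidakisVanDenDriesMacintyre1992_mainTheorem :=
  ChatzidakisVanDenDriesMacintyre1992_mainTheorem_holds_of
    ChatzidakisVanDenDriesMacintyre1992_prop33_holds h27

end Literature.ModelTheory.PseudofiniteFields

end
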